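import Literature.NumberTheory.Automorphic.Liu2021.AppendixC.HeckeEndomorphismPushPull
import HarnessLib

/-!
# `[Kg⁻¹K]` as a push–pull along the INVERTED transversal of `KgK` (the target of the transposed Hecke word)

Topic `NumberTheory/Automorphic/Liu2021/AppendixC`; namespace `Literature.NumberTheory.Automorphic.Liu2021.AppendixC.Sec42Data.HeckeTranslates`.
PROOF FILE (theorems only; no definition, no named fact, no instance, no `sorry`).  Corollary of ★ (P3) `heckeEnd_eq_pushPull`.

For a COMMON (two-sided) transversal `s` of `KgK` (★ `Automorphic.exists_common_transversal`: `KgK = ⊔_{γ∈s} γK = ⊔_{γ∈s} Kγ`, which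
exists as soon as `#(KgK/K) = #(Kg⁻¹K/K)`, e.g. for unimodular groups), the inverses `{γ⁻¹ : γ ∈ s}` form a left transversal of `Kg⁻¹K`
(the hypothesis `hs'` below, the shape of ★ `heckeOperator_inv_apply_eq_sum`).  Hence, for a small level `N'' ⊴ K` admissible for every
`γ⁻¹` (`γN''γ⁻¹ ⊆ K`) and an Albanese trace `τ : A_K ⟶ A_{N''}` of `X_{N''} → X_K`:

* **`heckeEnd_inv_eq_pushPull`** — `[Kg⁻¹K] = (card ι)⁻¹ · (1 ⊗ (τ ≫ Σ_{γ ∈ s} Alb T_{γ⁻¹}))` in `End⁰(A_K)` ([Bump1997] Prop. 4.2.3 at `g⁻¹`;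
  (P3) at the transversal `s⁻¹`, re-indexed along `γ ↦ γ⁻¹`).

Use (cell `hodgecm-mathlib`, D-0151, crux `HLiu418` = stmt-HodgeConjecture-24832, d6 line road (P), `stub_RosH` glue): the Rosati/level
transpose of the push–pull word of `[KgK]` ((P3) at `(g, N, s)`) is, entry by entry on the complex Jacobians, the push–pull word of THIS
presentation of `[Kg⁻¹K]` (at `(g⁻¹, N'', s⁻¹)`) — the classical `[KgK]^t = [Kg⁻¹K]` ([Lange2023AbelianVarietiesComplex] / [LangeRodriguez2022]
§3.5 for the correspondence transpose; [Liu2021] p. 133 (D.3)); this file names the target so that the (L) leg proves membership in the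
Hecke image by ★ `algEquiv_symm_endAlgebraBaseChange_heckeEnd_eq_word` at `g⁻¹`.  COUNT-NEUTRAL capital: HC_CM is proved only modulo the
7 printed citations until rung 0 closes.

## References
* [Liu2021] Y. Liu, *Fourier–Jacobi cycles and arithmetic relative trace formula*, Camb. J. Math. 9 (2021): §4.2 (FJcycle.tex l. 2074),
  p. 133 (before (D.3)).
* [Bump1997] D. Bump, *Automorphic Forms and Representations* (1997), §4.2 Prop. 4.2.3.
* [LangeRodriguez2022] H. Lange, R. E. Rodríguez, *Decomposition of Jacobians by Prym Varieties*, LNM 2310 (2022), §3.5.1 Prop. 3.5.1 (p. 65).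
-/

set_option autoImplicit false

noncomputable section

open CategoryTheory NumberField Function MulAction
open scoped TensorProduct

namespace Literature.NumberTheory.Automorphic.Liu2021.AppendixC

open Literature.AlgebraicGeometry.Motives (AbelianVariety)
open Literature.AlgebraicGeometry.Motives.AbelianVariety (rationalTateModuleMap endAlgebra)

variable {F E : Type} [Field F] [NumberField F] [IsTotallyReal F] [Field E] [NumberField E] [Algebra F E]
  [IsTotallyComplex E] [Algebra.IsQuadraticExtension F E]
variable {P5 : PropC5Data F E} {isotropicAt : ℕ → Prop}

namespace Sec42Data.HeckeTranslates

variable {C : Sec42Data P5 isotropicAt} (T : C.HeckeTranslates) (ℓ : ℕ) [Fact ℓ.Prime]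

/-- Re-indexing bookkeeping: if `γ ↦ γ⁻¹K` is a bijection from `s` onto the `K`-orbit of `g⁻¹K`, then `γ' ↦ γ'K` is a bijection from the
inverted finset `s⁻¹ = {γ⁻¹}` onto it (inversion is injective). [folklore] -/
private theorem bijOn_image_inv {G : Type*} [Group G] [DecidableEq G] (K : Subgroup G) (g : G) (s : Finset G)
    (hs' : Set.BijOn (fun x : G => ((x⁻¹ : G) : G ⧸ K)) s (orbit K ((g⁻¹ : G) : G ⧸ K))) :
    Set.BijOn (fun x : G => (x : G ⧸ K)) (s.image fun x : G => x⁻¹) (orbit K ((g⁻¹ : G) : G ⧸ K)) := by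
  refine ⟨?_, ?_, ?_⟩
  · intro y hy
    obtain ⟨x, hx, rfl⟩ := Finset.mem_image.1 (Finset.mem_coe.1 hy)
    exact hs'.1 (Finset.mem_coe.2 hx)
  · intro y hy y' hy' h
    obtain ⟨x, hx, rfl⟩ := Finset.mem_image.1 (Finset.mem_coe.1 hy)
    obtain ⟨x', hx', rfl⟩ := Finset.mem_image.1 (Finset.mem_coe.1 hy')
    rw [hs'.2.1 (Finset.mem_coe.2 hx) (Finset.mem_coe.2 hx') h]
  · intro y hy
    obtain ⟨x, hx, rfl⟩ := hs'.2.2 hy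
    exact ⟨x⁻¹, Finset.mem_coe.2 (Finset.mem_image.2 ⟨x, Finset.mem_coe.1 hx, rfl⟩), rfl⟩

/-- **`[Kg⁻¹K] = (card ι)⁻¹ · (τ ≫ Σ_{γ ∈ s} Alb T_{γ⁻¹})`** for a finset `s` whose INVERSES form a transversal of `Kg⁻¹K/K` (e.g. a common
transversal of `KgK`, ★ `exists_common_transversal`), a small level `N'' ⊴ K` (`hn`) admissible for every `γ⁻¹` (`hsN : γN''γ⁻¹ ⊆ K`), and an
Albanese trace `τ : A_K ⟶ A_{N''}` of the level cover pinned by `Alb_u ≫ τ = Σ_i Alb T_{δ_i}` (`δ_i ∈ K`, `ι ≠ ∅`): ★ (P3)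
`heckeEnd_eq_pushPull` at `g⁻¹` along the transversal `s⁻¹`, re-indexed by `γ ↦ γ⁻¹` (★ `albTr_congr` absorbs the spelling of `γ⁻¹`).
[cite: Liu2021, p. 133 (before (D.3)) and §4.2 (FJcycle.tex l. 2074)] [cite: Bump1997, §4.2 (Prop. 4.2.3)] -/
theorem heckeEnd_inv_eq_pushPull (hD : T.IsogenyDescent)
    (hI : ∀ ⦃K K' : C5.SmallLevel C.S.K₀⦄ (f : K' ⟶ K), Function.Injective (rationalTateModuleMap ℓ (C.Atr f)).dualMap)
    {N K : C5.SmallLevel C.S.K₀} (h : N ≤ K) (hn : ∀ k ∈ K.1.1, C5.HeckeLE k N N)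
    {ι : Type*} [Fintype ι] [Nonempty ι] (δ : ι → C.G) (hδ : ∀ i, δ i ∈ K.1.1) (t : C.A K ⟶ C.A N)
    (ht : C.Atr (homOfLE h) ≫ t = ∑ i, T.albTr (δ i) N N (hn _ (hδ i)))
    (g : C.G) (s : Finset C.G)
    (hs' : Set.BijOn (fun x : C.G => ((x⁻¹ : C.G) : C.G ⧸ (K.1.1 : Subgroup C.G))) s
      (orbit K.1.1 ((g⁻¹ : C.G) : C.G ⧸ (K.1.1 : Subgroup C.G))))
    (hsN : ∀ γ ∈ s, C5.HeckeLE γ⁻¹ N K) :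
    T.heckeEnd hD K g⁻¹ =
      algebraMap ℚ (C.A K).endAlgebra ((Fintype.card ι : ℚ))⁻¹ *
        endAlgebra.of (C.A K) (t ≫ ∑ γ ∈ s.attach, T.albTr ((γ : C.G)⁻¹) N K (hsN γ γ.2)) := by
  classical
  -- (P3) at `g⁻¹` along the left transversal `s⁻¹`
  have hsN' : ∀ γ' ∈ s.image (fun x : C.G => x⁻¹), C5.HeckeLE γ' N K := by
    intro γ' hγ'
    obtain ⟨x, hx, rfl⟩ := Finset.mem_image.1 hγ'
    exact hsN x hx
  have hP3 := T.heckeEnd_eq_pushPull ℓ hD hI h hn δ hδ t ht g⁻¹ (s.image fun x : C.G => x⁻¹)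
    (bijOn_image_inv (K.1.1 : Subgroup C.G) g s hs') hsN'
  rw [hP3]
  congr 2
  -- re-index the sum along `γ ↦ γ⁻¹` through a proof-irrelevant total function
  let A : C.G → (C.A N ⟶ C.A K) := fun x => if hx : C5.HeckeLE x N K then T.albTr x N K hx else 0
  have hA : ∀ (x : C.G) (hx : C5.HeckeLE x N K), T.albTr x N K hx = A x := fun x hx => by
    simp only [A, dif_pos hx]
  have h1 : ∑ γ' ∈ (s.image fun x : C.G => x⁻¹).attach, T.albTr (γ' : C.G) N K (hsN' γ' γ'.2) =
      ∑ γ' ∈ s.image (fun x : C.G => x⁻¹), A γ' := by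
    rw [← Finset.sum_attach (s.image fun x : C.G => x⁻¹) A]
    exact Finset.sum_congr rfl fun γ' _ => hA _ _
  have h2 : ∑ γ ∈ s.attach, T.albTr ((γ : C.G)⁻¹) N K (hsN γ γ.2) = ∑ γ ∈ s, A γ⁻¹ := by
    rw [← Finset.sum_attach s (fun γ => A γ⁻¹)]
    exact Finset.sum_congr rfl fun γ _ => hA _ _
  rw [h1, h2, Finset.sum_image fun x _ y _ hxy => inv_injective hxy]

end Sec42Data.HeckeTranslates

end Literature.NumberTheory.Automorphic.Liu2021.AppendixC

end
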